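import Summits.ABC.ABC.Theses.IsogenyGlueCongruence
import Summits.ABC.ABC.Theses.RibetTakahashiSplit
import Summits.ABC.ABC.Theorems.IsogenyGlueCongruenceMazurKenkuBoundOfRadius
import Summits.ABC.ABC.Theorems.IsogenyGlueCongruenceMazurKenkuBoundStubCertEleven
import Summits.ABC.ABC.Theorems.IsogenyGlueCongruenceMazurKenkuBoundStubCertMid
import Summits.ABC.ABC.Theorems.IsogenyGlueCongruenceMazurKenkuBoundStubCertCM
import Summits.ABC.ABC.Theorems.IsogenyGlueCongruenceMazurKenkuBoundStubEightyone
import Literature.NumberTheory.EllipticCurves.KenkuMinimalLevelsKleinFrickeFiveSeven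
import Literature.NumberTheory.EllipticCurves.OpenImageMazurInputsProofs
import HarnessLib

/-!
# `MazurKenkuBound` (stmt-ABC-15125) and the Mazur–Kenku radius (stmt-ABC-15193) from EXACTLY
# the three printed inputs that have no counterpart in the tree

Route `IsogenyGlueCongruence`, crux `MazurKenkuBound`, line `Sketch` (lead c21, cycle 22,
2026-08-17). Sorry-free, axiom-clean companion of the registered skeleton
`Cruxes/MazurKenkuBound/Lines/Sketch.lean`: the crux — and the sibling crux
`RibetTakahashiSplit.MazurKenkuRadius` (stmt-ABC-15193), two `ℚ`-isogenous elliptic curves over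
`ℚ` are joined by a `ℚ`-isogeny of degree `≤ 163` — CONDITIONAL on, and only on,

* (`h44`) Mazur 1978, Cor. 4.4 (`Mazur1978.cor44_valuation_j_le_one`: the Eisenstein quotient of
  `J₀(N)` — finiteness of `J̃(ℚ)` and the formal immersion at `∞`);
* (`hU`, `hT`) Kenku's tables: uniqueness of the rational cyclic `N`-subgroup and the `j`-tables
  `kenkuIsogenyJTable` of the rational cyclic `N`-isogenies, `N ∈ {11, 14, 15, 17, 19, 21, 27, 37,
  43, 67, 163}` (determinations of `X₀(N)(ℚ)`: Ligozat, Vélu, Mazur–Swinnerton-Dyer, Mazur);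
* (`hD`) the thirteen direct levels `Y₀(N)(ℚ) = ∅`, `N ∈ {20, 24, 26, 32, 35, 36, 39, 49, 50, 65, 91,
  125, 169}` (Ligozat, Kubert, Mazur–Vélu, Kenku 1979–81),

each displayed verbatim as a hypothesis (the schemas `hU`, `hT` and the residual of `hRest` of
the tree's axiom-clean `kenku_minimalLevels_mem_kenkuDegrees_of_schemas`). Everything else of
Mazur's Theorem 1 and of Kenku's assembly is a THEOREM of the tree, used here by name:
Prop. 5.1 (`Mazur1978.prop51_exponent_classes_of_additive_holds`), §§5–7 of Mazur
(`mazur_isogeny_irreducible_holds_of`), the cyclic reduction and divisor closure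
(`mazurKenku_exists_cyclic_isogeny_of_mazur_of_kenku`, `Isogeny.exists_isCyclic_degree_eq_of_dvd`),
Kenku's two-subgroups lemma and case (a), Klein–Fricke at `2, 3, 5`
(`kenku_minimalLevels_mem_kenkuDegrees_of_schemas`, `isCyclic_degree_ne_five_mul_of_jTable`),
and — NEW this cycle, landed as the four certificate stubs of the line — Kenku's case (c) at
`N' ∈ {7, 13}` and the level `81` by Frobenius certificates (`stub_certEleven`, `stub_certMid`,
`stub_certCM`, `stub_eightyone` over `RationalIsogenyFrobeniusCriterion.lean`). The Néron/Edixhoven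
half of the crux is the theorem `mazurKenkuBound_of_radiusItem` (p135527).

So the formal debt of BOTH cruxes is, after this file, precisely {Cor. 4.4; `X₀(N)(ℚ)` for the
eleven table levels (with uniqueness); `Y₀(N)(ℚ) = ∅` for the thirteen direct levels}.
-/

-- `Summit.<Summit>.<Problem>` is the mandated summit-side namespace (CONVENTIONS §2); for the
-- single-conjunct summit `ABC` the two coincide, so the duplicate `ABC.ABC` is deliberate.
set_option linter.dupNamespace false

noncomputable section

open scoped Classical

open WeierstrassCurve
open Literature.NumberTheory.EllipticCurves

namespace Summit.ABC.ABC.Theorems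

/-- The 35 residual levels of `kenku_minimalLevels_mem_kenkuDegrees_of_schemas` split as: the 13
direct levels, `5N`, `7N`, `13N` for `N ∈ {11, 17, 19, 37, 43, 67, 163}`, and `81` (finite check).
[cite: Kenku1982, proof of Thm. 1, pp. 200–201] -/
theorem kenkuResidualLevels_split :
    ∀ n ∈ ({20, 24, 26, 32, 35, 36, 39, 49, 50, 65, 91, 125, 169, 55, 85, 95, 185, 215, 335, 815,
        77, 119, 133, 259, 301, 469, 1141, 143, 221, 247, 481, 559, 871, 2119, 81} : Finset ℕ),
      n ∈ ({20, 24, 26, 32, 35, 36, 39, 49, 50, 65, 91, 125, 169} : Finset ℕ) ∨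
        (∃ N ∈ ({11, 17, 19, 37, 43, 67, 163} : Finset ℕ), n = 5 * N) ∨
        (∃ N ∈ ({11, 17, 19, 37, 43, 67, 163} : Finset ℕ), n = 7 * N) ∨
        (∃ N ∈ ({11, 17, 19, 37, 43, 67, 163} : Finset ℕ), n = 13 * N) ∨ n = 81 := by
  decide

/-- The large-prime entries of `kenkuIsogenyJTable` have their `j` among the eleven tabulated
values, grouped as in the three certificate stubs (finite check).
[cite: CremonaAlgorithms1997, §3.8 p. 82] -/
theorem kenkuIsogenyJTable_snd_mem_of_large :
    ∀ r ∈ kenkuIsogenyJTable, r.1 ∈ ({11, 17, 19, 37, 43, 67, 163} : Finset ℕ) →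
      r.2 ∈ ({-121, -24729001, -32768} : Finset ℚ) ∨
        r.2 ∈ ({-297756989 / 2, -882216989 / 131072, -884736, -9317, -162677523113838677} :
          Finset ℚ) ∨
        r.2 ∈ ({-884736000, -147197952000, -262537412640768000} : Finset ℚ) := by
  decide +kernel

/-- The only entry of `kenkuIsogenyJTable` at level `27` is `j = -12288000` (finite check).
[cite: Kenku1982, proof of Thm. 1, p. 200] -/
theorem kenkuIsogenyJTable_snd_eq_of_twentyseven :
    ∀ r ∈ kenkuIsogenyJTable, r.1 = 27 → r.2 = -12288000 := by
  decide +kernel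

/-- **The residual schema `hRest` of `kenku_minimalLevels_mem_kenkuDegrees_of_schemas` from the
`j`-tables and the thirteen direct levels alone** (Kenku 1982, proof of Thm. 1, case (c) at
`N' ∈ {5, 7, 13}` and the level `81`): a cyclic `ℚ`-isogeny `ψ` has degree outside the 35
residual levels. Direct levels: `hD`; `5N`: the tree's axiom-clean Klein–Fricke theorem
`isCyclic_degree_ne_five_mul_of_jTable`; `7N`, `13N`: the cyclic `N`-sub-isogeny out of the same
curve (`Isogeny.exists_isCyclic_degree_eq_of_dvd`) puts `j` in the table (`hT`), and the `7`- resp.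
`13`-sub-isogeny is excluded by the landed certificate theorems `stub_certEleven`, `stub_certMid`,
`stub_certCM`; `81`: the cyclic `27`-sub-isogeny gives `j = -12288000` (`hT`) and the landed
`stub_eightyone` applies. [cite: Kenku1982, proof of Thm. 1, pp. 200–201]
[cite: Mazur1978, §6 Prop. 6.3 (1) (p. 153)] -/
theorem kenkuRest_of_jTable_of_direct
    (hT : ∀ (V V' : WeierstrassCurve ℚ) [V.IsElliptic] [V'.IsElliptic] (ψ : Isogeny V V'),
      ψ.IsCyclic → ψ.degree ∈ ({11, 14, 15, 17, 19, 21, 27, 37, 43, 67, 163} : Finset ℕ) →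
        (ψ.degree, V.j) ∈ kenkuIsogenyJTable)
    (hD : ∀ (V V' : WeierstrassCurve ℚ) [V.IsElliptic] [V'.IsElliptic] (ψ : Isogeny V V'),
      ψ.IsCyclic →
        ψ.degree ∉ ({20, 24, 26, 32, 35, 36, 39, 49, 50, 65, 91, 125, 169} : Finset ℕ)) :
    ∀ (V V' : WeierstrassCurve ℚ) [V.IsElliptic] [V'.IsElliptic] (ψ : Isogeny V V'),
      ψ.IsCyclic → ψ.degree ∉ ({20, 24, 26, 32, 35, 36, 39, 49, 50, 65, 91, 125, 169, 55, 85,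
        95, 185, 215, 335, 815, 77, 119, 133, 259, 301, 469, 1141, 143, 221, 247, 481, 559, 871,
        2119, 81} : Finset ℕ) := by
  intro V V' _ _ ψ hψ hmem
  have hB : ∀ N ∈ ({11, 17, 19, 37, 43, 67, 163} : Finset ℕ),
      N ∈ ({11, 14, 15, 17, 19, 21, 27, 37, 43, 67, 163} : Finset ℕ) := by decide
  -- a prime-degree sub-isogeny `q ∣ deg ψ` together with a tabulated `N`-sub-isogeny is excluded
  have key : ∀ {q N : ℕ}, (q = 7 ∨ q = 13) → N ∈ ({11, 17, 19, 37, 43, 67, 163} : Finset ℕ) →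
      ψ.degree = q * N → False := by
    intro q N hq hN hd
    obtain ⟨V₂, hV₂, ψN, hψNc, hψNd, -⟩ :=
      ψ.exists_isCyclic_degree_eq_of_dvd hψ (d := N) (hd ▸ dvd_mul_left N q)
    obtain ⟨V₃, hV₃, χ, -, hχd, -⟩ :=
      ψ.exists_isCyclic_degree_eq_of_dvd hψ (d := q) (hd ▸ dvd_mul_right q N)
    haveI := hV₂
    haveI := hV₃
    have hmemT := hT V V₂ ψN hψNc (hψNd ▸ hB N hN)
    rw [hψNd] at hmemT
    have hχq : χ.degree = 7 ∨ χ.degree = 13 := by rw [hχd]; exact hq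
    rcases kenkuIsogenyJTable_snd_mem_of_large _ hmemT hN with hj | hj | hj
    · exact stub_certEleven V V₃ χ hχq hj
    · exact stub_certMid V V₃ χ hχq hj
    · exact stub_certCM V V₃ χ hχq hj
  rcases kenkuResidualLevels_split _ hmem with hdir | ⟨N, hN, hd⟩ | ⟨N, hN, hd⟩ | ⟨N, hN, hd⟩ |
      h81
  · exact hD V V' ψ hψ hdir
  · exact isCyclic_degree_ne_five_mul_of_jTable hT ψ hψ hN hd
  · exact key (Or.inl rfl) hN hd
  · exact key (Or.inr rfl) hN hd
  · obtain ⟨V₂, hV₂, ψ₂₇, hc, hd27, -⟩ :=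
      ψ.exists_isCyclic_degree_eq_of_dvd hψ (d := 27) (h81 ▸ (by norm_num : (27 : ℕ) ∣ 81))
    haveI := hV₂
    have hmemT := hT V V₂ ψ₂₇ hc (by rw [hd27]; decide)
    rw [hd27] at hmemT
    exact stub_eightyone V V' ψ hψ h81 (kenkuIsogenyJTable_snd_eq_of_twentyseven _ hmemT rfl)

/-- **Kenku's composite levels from the tables and the thirteen direct levels**:
`kenku_minimalLevels_mem_kenkuDegrees` from `hU`, `hT`, `hD` (the tree's axiom-clean assembly fed
with `kenkuRest_of_jTable_of_direct`). [cite: Kenku1982, Thm. 1 and its proof, pp. 199–201] -/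
theorem kenku_of_tables_of_direct
    (hU : ∀ N ∈ ({11, 17, 19, 37, 43, 67, 163, 14, 15, 21} : Finset ℕ),
      ∀ (V V₂ V₃ : WeierstrassCurve ℚ) [V.IsElliptic] [V₂.IsElliptic] [V₃.IsElliptic]
        (ψ₁ : Isogeny V V₂) (ψ₂ : Isogeny V V₃), ψ₁.IsCyclic → ψ₂.IsCyclic →
        ψ₁.degree = N → ψ₂.degree = N → ψ₁.toAddMonoidHom.ker = ψ₂.toAddMonoidHom.ker)
    (hT : ∀ (V V' : WeierstrassCurve ℚ) [V.IsElliptic] [V'.IsElliptic] (ψ : Isogeny V V'),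
      ψ.IsCyclic → ψ.degree ∈ ({11, 14, 15, 17, 19, 21, 27, 37, 43, 67, 163} : Finset ℕ) →
        (ψ.degree, V.j) ∈ kenkuIsogenyJTable)
    (hD : ∀ (V V' : WeierstrassCurve ℚ) [V.IsElliptic] [V'.IsElliptic] (ψ : Isogeny V V'),
      ψ.IsCyclic →
        ψ.degree ∉ ({20, 24, 26, 32, 35, 36, 39, 49, 50, 65, 91, 125, 169} : Finset ℕ)) :
    kenku_minimalLevels_mem_kenkuDegrees :=
  kenku_minimalLevels_mem_kenkuDegrees_of_schemas hU hT (kenkuRest_of_jTable_of_direct hT hD)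

/-- **The Mazur–Kenku radius (stmt-ABC-15193, `RibetTakahashiSplit.MazurKenkuRadius`) from
Cor. 4.4, Kenku's tables and the thirteen direct levels**: Mazur's Thm. 1 from `h44` and the
tree's proof of Prop. 5.1 (`mazur_isogeny_irreducible_holds_of`), Kenku's fact from
`kenku_of_tables_of_direct`, then `mazurKenku_exists_cyclic_isogeny_of_mazur_of_kenku` and
`exists_isogeny_degree_le_163`. CONDITIONAL (three displayed hypotheses).
[cite: Mazur1978, Thm. 1 (pp. 129–130), Cor. 4.4 (p. 145)] [cite: Kenku1982, Thm. 1]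
[cite: SilvermanAEC2009, IX.6 Example 6.4] -/
theorem mazurKenkuRadius_of_cor44_of_kenkuTables_of_kenkuDirect
    (h44 : Mazur1978.cor44_valuation_j_le_one)
    (hU : ∀ N ∈ ({11, 17, 19, 37, 43, 67, 163, 14, 15, 21} : Finset ℕ),
      ∀ (V V₂ V₃ : WeierstrassCurve ℚ) [V.IsElliptic] [V₂.IsElliptic] [V₃.IsElliptic]
        (ψ₁ : Isogeny V V₂) (ψ₂ : Isogeny V V₃), ψ₁.IsCyclic → ψ₂.IsCyclic →
        ψ₁.degree = N → ψ₂.degree = N → ψ₁.toAddMonoidHom.ker = ψ₂.toAddMonoidHom.ker)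
    (hT : ∀ (V V' : WeierstrassCurve ℚ) [V.IsElliptic] [V'.IsElliptic] (ψ : Isogeny V V'),
      ψ.IsCyclic → ψ.degree ∈ ({11, 14, 15, 17, 19, 21, 27, 37, 43, 67, 163} : Finset ℕ) →
        (ψ.degree, V.j) ∈ kenkuIsogenyJTable)
    (hD : ∀ (V V' : WeierstrassCurve ℚ) [V.IsElliptic] [V'.IsElliptic] (ψ : Isogeny V V'),
      ψ.IsCyclic →
        ψ.degree ∉ ({20, 24, 26, 32, 35, 36, 39, 49, 50, 65, 91, 125, 169} : Finset ℕ)) :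
    Summit.ABC.ABC.Theses.RibetTakahashiSplit.MazurKenkuRadius :=
  fun W W' _ _ hW ↦ exists_isogeny_degree_le_163
    (mazurKenku_exists_cyclic_isogeny_of_mazur_of_kenku
      (mazur_isogeny_irreducible_holds_of h44 Mazur1978.prop51_exponent_classes_of_additive_holds)
      (kenku_of_tables_of_direct hU hT hD)) W W' hW

/-- **The crux `MazurKenkuBound` (stmt-ABC-15125) from Cor. 4.4, Kenku's tables and the
thirteen direct levels** — the landed `mazurKenkuBound_of_radiusItem` (p135527; Edixhoven input =
theorem `edixhovenIntegrality_proof`, p135258) on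
`mazurKenkuRadius_of_cor44_of_kenkuTables_of_kenkuDirect`. CONDITIONAL (three displayed
hypotheses = the three remaining registered stubs `stub_cor44`, `stub_kenkuTablesUnique`,
`stub_kenkuDirect` of line `Sketch`). [cite: PastenShimura2024, §3 p. 13]
[cite: Mazur1978, Thm. 1, Cor. 4.4] [cite: Kenku1982, Thm. 1] [cite: EdixhovenManin1991, Prop. 2] -/
theorem mazurKenkuBound_of_cor44_of_kenkuTables_of_kenkuDirect
    (h44 : Mazur1978.cor44_valuation_j_le_one)
    (hU : ∀ N ∈ ({11, 17, 19, 37, 43, 67, 163, 14, 15, 21} : Finset ℕ),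
      ∀ (V V₂ V₃ : WeierstrassCurve ℚ) [V.IsElliptic] [V₂.IsElliptic] [V₃.IsElliptic]
        (ψ₁ : Isogeny V V₂) (ψ₂ : Isogeny V V₃), ψ₁.IsCyclic → ψ₂.IsCyclic →
        ψ₁.degree = N → ψ₂.degree = N → ψ₁.toAddMonoidHom.ker = ψ₂.toAddMonoidHom.ker)
    (hT : ∀ (V V' : WeierstrassCurve ℚ) [V.IsElliptic] [V'.IsElliptic] (ψ : Isogeny V V'),
      ψ.IsCyclic → ψ.degree ∈ ({11, 14, 15, 17, 19, 21, 27, 37, 43, 67, 163} : Finset ℕ) →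
        (ψ.degree, V.j) ∈ kenkuIsogenyJTable)
    (hD : ∀ (V V' : WeierstrassCurve ℚ) [V.IsElliptic] [V'.IsElliptic] (ψ : Isogeny V V'),
      ψ.IsCyclic →
        ψ.degree ∉ ({20, 24, 26, 32, 35, 36, 39, 49, 50, 65, 91, 125, 169} : Finset ℕ)) :
    Summit.ABC.ABC.Theses.IsogenyGlueCongruence.MazurKenkuBound :=
  mazurKenkuBound_of_radiusItem (mazurKenkuRadius_of_cor44_of_kenkuTables_of_kenkuDirect h44 hU hT hD)

end Summit.ABC.ABC.Theorems

end
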